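import Literature.AlgebraicGeometry.Motives.MixedHodgeStructureSubadditiveFunctions
import Literature.AlgebraicGeometry.Motives.MixedHodgeStructureMultiplicityBounds
import Literature.AlgebraicGeometry.Motives.MixedHodgeStructureHodgeTate
import HarnessLib

/-!
# Hodge numbers bound the morphisms: `dim_ℚ Hom_MHS(H₁, H₂) ≤ Σ_{p,q} h^{p,q}(H₁) · h^{p,q}(H₂)`

A morphism of mixed Hodge structures is a rational class of type `(0, 0)` of the internal `Hom`
(`Hom_MHS(H₁, H₂) ≃ Hdg⁰(Hom(H₁, H₂))`, Deligne, *Hodge II*, 1.1.12 and 2.1.11.1; the tree's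
`MixedHodgeStructureInternalHomFiltrations`), rational `(0,0)`-classes are `ℚ`-linearly independent vectors of the
`ℂ`-space `I^{0,0}`, so `dim_ℚ Hdg⁰ ≤ h^{0,0}` (the tree's `finrank_hodgeClasses_le_hodgeNumber`, Jannsen 7.8), and
Cattani–El Zein–Griffiths–Lê, §3.2.2.7: the Hodge numbers of `Hom(H₁, H₂) ≅ H₁^∨ ⊗ H₂` are
`h^{p,q}(Hom(H₁,H₂)) = Σ_{a,b} h^{-a,-b}(H₁) h^{p-a,q-b}(H₂)` (`hodgeNumber_hom`). Equivalently: complexified, a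
morphism preserves Deligne's bigrading, `Hom_MHS(H₁, H₂) ⊗ ℂ ⊆ ⊕_{p,q} Hom_ℂ(I^{p,q}H₁, I^{p,q}H₂)`. For an abelian
variety `A` of dimension `g` this is the classical `ρ_r ⊗ 1 ≃ ρ_a ⊕ \bar ρ_a` (Lange–Rodríguez (2.6)), giving
`[End_ℚ(A) : ℚ] ≤ 2g²`. This file proves:

* §1 `h^{0,0}(Hom(H₁, H₂)) = Σ_{a,b} h^{a,b}(H₁) · h^{a,b}(H₂)` (`hodgeNumber_hom_zero_zero`), and the bound
  **`dim_ℚ Hom_MHS(H₁, H₂) ≤ Σ_{a,b} h^{a,b}(H₁) · h^{a,b}(H₂)`** (`finrank_hom_le_finsum_hodgeNumber`); in particular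
  **`dim_ℚ End_MHS(H) ≤ Σ_{a,b} h^{a,b}(H)²`** and `Hom_MHS(H₁, H₂) = 0` when `H₁`, `H₂` have no common Hodge type.
* §2 pure structures of weight `n`: the sum runs over `a + b = n` only; **weight one with Hodge types
  `{(1,0), (0,1)}`: `dim_ℚ Hom_MHS(H₁, H₂) ≤ h^{1,0}(H₁) h^{1,0}(H₂) + h^{0,1}(H₁) h^{0,1}(H₂)` and
  `dim_ℚ End_MHS(H) ≤ 2 · h^{1,0}(H)²`** (`= 2g²` for `H = H¹` of a `g`-dimensional abelian variety or complex torus).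

All statements proved; no definitions, no named facts, no instances.

## References

* [CattaniElZeinGriffithsLe2014] E. Cattani et al. (eds.), Hodge Theory (2014), §3.2.2.6 (Hodge numbers of a MHS),
  §3.2.2.7 (`Hom` and tensor of MHS), Prop. 3.2.19.
* [DeligneHodgeII1971] P. Deligne, Théorie de Hodge II, 1.1.11–1.1.12, 2.1.11.1, 2.1.13.
* [Jannsen1990MixedMotives] U. Jannsen, Mixed Motives and Algebraic K-Theory, LNM 1400 (1990), 7.8 (p. 94).
* [LangeRodriguez2022] H. Lange, R. E. Rodríguez, Decomposition of Jacobians by Prym Varieties, LNM 2310 (2022),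
  §2.1 eq. (2.6) `ρ_r ⊗ 1 ≃ ρ_a ⊕ \bar ρ_a` (held text, chunk p0029).
-/

noncomputable section

namespace Literature.AlgebraicGeometry.Motives

namespace MixedHodgeStructure

open Module

universe u v

variable {V : Type u} [AddCommGroup V] [Module ℚ V] [FiniteDimensional ℚ V]
variable {V' : Type v} [AddCommGroup V'] [Module ℚ V'] [FiniteDimensional ℚ V']

/-! ### §1 The general bound -/

/-- **`h^{0,0}(Hom(H₁, H₂)) = Σ_{a,b} h^{a,b}(H₁) · h^{a,b}(H₂)`** (from `h^{p,q}(Hom) = Σ h^{-a,-b}(H₁) h^{p-a,q-b}(H₂)` at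
`p = q = 0`, reindexed by `(a, b) ↦ (-a, -b)`). [cite: CattaniElZeinGriffithsLe2014, §3.2.2.7] -/
theorem hodgeNumber_hom_zero_zero (H₁ : MixedHodgeStructure V) (H₂ : MixedHodgeStructure V') :
    (hom H₁ H₂).hodgeNumber 0 0 = ∑ᶠ (a : ℤ) (b : ℤ), H₁.hodgeNumber a b * H₂.hodgeNumber a b := by
  rw [hodgeNumber_hom]
  simp only [zero_sub]
  rw [← finsum_comp (g := fun a => ∑ᶠ b, H₁.hodgeNumber a b * H₂.hodgeNumber a b) Neg.neg neg_involutive.bijective]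
  refine finsum_congr fun a => ?_
  exact (finsum_comp (g := fun b => H₁.hodgeNumber (-a) b * H₂.hodgeNumber (-a) b) Neg.neg
    neg_involutive.bijective)

/-- **Hodge numbers bound the morphisms: `dim_ℚ Hom_MHS(H₁, H₂) ≤ Σ_{a,b} h^{a,b}(H₁) · h^{a,b}(H₂)`**
(`Hom_MHS = Hdg⁰(Hom)`, `dim_ℚ Hdg⁰ ≤ h^{0,0}`). [cite: DeligneHodgeII1971, 1.1.12 and 2.1.11.1]
[cite: Jannsen1990MixedMotives, 7.8 (p. 94)] [cite: CattaniElZeinGriffithsLe2014, §3.2.2.7] -/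
theorem finrank_hom_le_finsum_hodgeNumber (H₁ : MixedHodgeStructure V) (H₂ : MixedHodgeStructure V') :
    finrank ℚ ((hom H₁ H₂).hodgeClasses 0) ≤ ∑ᶠ (a : ℤ) (b : ℤ), H₁.hodgeNumber a b * H₂.hodgeNumber a b := by
  rw [← hodgeNumber_hom_zero_zero]
  exact finrank_hodgeClasses_le_hodgeNumber (hom H₁ H₂) 0

/-- **`dim_ℚ End_MHS(H) ≤ Σ_{a,b} h^{a,b}(H)²`.** [cite: DeligneHodgeII1971, 1.1.12 and 2.1.11.1]
[cite: CattaniElZeinGriffithsLe2014, §3.2.2.7] -/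
theorem finrank_end_le_finsum_hodgeNumber_sq (H : MixedHodgeStructure V) :
    finrank ℚ ((hom H H).hodgeClasses 0) ≤ ∑ᶠ (a : ℤ) (b : ℤ), H.hodgeNumber a b ^ 2 := by
  have h := finrank_hom_le_finsum_hodgeNumber H H
  simp only [← sq] at h
  exact h

/-- **MHS without a common Hodge type admit only the zero morphism**: if `h^{a,b}(H₁) · h^{a,b}(H₂) = 0` for all
`(a, b)`, then every morphism `H₁ → H₂` vanishes. [cite: DeligneHodgeII1971, 1.1.11 and 2.1.13]
[cite: CattaniElZeinGriffithsLe2014, §3.2.2.7] -/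
theorem hom_eq_zero_of_forall_hodgeNumber_mul_eq_zero {H₁ : MixedHodgeStructure V} {H₂ : MixedHodgeStructure V'}
    (h : ∀ a b, H₁.hodgeNumber a b * H₂.hodgeNumber a b = 0) (f : Hom H₁ H₂) : f = Hom.zero H₁ H₂ := by
  refine forall_hom_eq_zero_iff_finrank_eq_zero.2 ?_ f
  refine Nat.le_zero.1 ((finrank_hom_le_finsum_hodgeNumber H₁ H₂).trans_eq ?_)
  exact finsum_eq_zero_of_forall_eq_zero fun a => finsum_eq_zero_of_forall_eq_zero fun b => h a b

/-! ### §2 Pure structures; weight one -/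

/-- A pure MHS of weight `n` has `h^{p,q} = 0` off the line `p + q = n` (a local copy of the tree's
`IsPure.hodgeNumber_eq_zero_of_ne` from `HodgeTheory/LimitMixedHodgeStructureRelativeStarHodgeNumbers`, to keep the
imports light). [cite: CattaniElZeinGriffithsLe2014, §3.2.2.6 and Def. 3.2.15] -/
private theorem hodgeNumber_eq_zero_of_isPure {H : MixedHodgeStructure V} {n : ℤ} (hH : H.IsPure n) {p q : ℤ}
    (hpq : p + q ≠ n) : H.hodgeNumber p q = 0 := by
  have hW : H.W (p + q) = H.W (p + q - 1) := by
    rcases lt_or_gt_of_ne hpq with hlt | hgt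
    · rw [hH.1 _ hlt, hH.1 _ (by omega)]
    · rw [hH.2 _ hgt.le, hH.2 _ (by omega)]
  exact hodgeNumber_eq_zero_of_W_eq_W_pred H hW rfl

/-- **Pure of weight `n`: `dim_ℚ Hom_MHS(H₁, H₂) ≤ Σ_a h^{a,n-a}(H₁) · h^{a,n-a}(H₂)`.** [cite: DeligneHodgeII1971, 2.1.13]
[cite: CattaniElZeinGriffithsLe2014, §3.2.2.7] -/
theorem IsPure.finrank_hom_le_finsum_hodgeNumber {H₁ : MixedHodgeStructure V} {H₂ : MixedHodgeStructure V'} {n : ℤ}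
    (h₁ : H₁.IsPure n) :
    finrank ℚ ((MixedHodgeStructure.hom H₁ H₂).hodgeClasses 0) ≤
      ∑ᶠ a : ℤ, H₁.hodgeNumber a (n - a) * H₂.hodgeNumber a (n - a) := by
  refine (MixedHodgeStructure.finrank_hom_le_finsum_hodgeNumber H₁ H₂).trans_eq (finsum_congr fun a => ?_)
  refine finsum_eq_single _ (n - a) fun b hb => ?_
  rw [hodgeNumber_eq_zero_of_isPure h₁ (by omega), zero_mul]

/-- The double sum for structures with Hodge types in `{(1,0), (0,1)}`. [cite: CattaniElZeinGriffithsLe2014, §3.2.2.6] -/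
private theorem finsum_finsum_eq_of_weightOne {f g : ℤ → ℤ → ℕ}
    (hf : ∀ a b, f a b ≠ 0 → (a = 1 ∧ b = 0) ∨ (a = 0 ∧ b = 1)) :
    ∑ᶠ (a : ℤ) (b : ℤ), f a b * g a b = f 1 0 * g 1 0 + f 0 1 * g 0 1 := by
  have hzero : ∀ a b, ¬((a = 1 ∧ b = 0) ∨ (a = 0 ∧ b = 1)) → f a b * g a b = 0 := fun a b hab => by
    by_cases h0 : f a b = 0
    · rw [h0, zero_mul]
    · exact absurd (hf a b h0) hab
  have h1 : ∑ᶠ b, f 1 b * g 1 b = f 1 0 * g 1 0 :=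
    finsum_eq_single _ 0 fun b hb => hzero 1 b (by omega)
  have h0 : ∑ᶠ b, f 0 b * g 0 b = f 0 1 * g 0 1 :=
    finsum_eq_single _ 1 fun b hb => hzero 0 b (by omega)
  have hout : ∀ a, a ≠ 1 → a ≠ 0 → ∑ᶠ b, f a b * g a b = 0 := fun a ha1 ha0 =>
    finsum_eq_zero_of_forall_eq_zero fun b => hzero a b (by omega)
  rw [finsum_eq_sum_of_support_subset (s := {1, 0}) _ ?_]
  · rw [Finset.sum_pair (by decide), h1, h0]
  · intro a ha
    rw [Function.mem_support] at ha
    simp only [Finset.coe_insert, Finset.coe_singleton, Set.mem_insert_iff, Set.mem_singleton_iff]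
    by_contra hnot
    exact ha (hout a (fun h1 => hnot (Or.inl h1)) (fun h0 => hnot (Or.inr h0)))

/-- **Weight one: `dim_ℚ Hom_MHS(H₁, H₂) ≤ h^{1,0}(H₁) h^{1,0}(H₂) + h^{0,1}(H₁) h^{0,1}(H₂)`** when `H₁` has Hodge types in
`{(1,0), (0,1)}` (complexified morphisms preserve `H^{1,0}` and `H^{0,1}`; for abelian varieties
`ρ_r ⊗ 1 ≃ ρ_a ⊕ \bar ρ_a`). [cite: LangeRodriguez2022, §2.1 eq. (2.6)] [cite: CattaniElZeinGriffithsLe2014, §3.2.2.7] -/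
theorem finrank_hom_le_of_weightOne {H₁ : MixedHodgeStructure V} {H₂ : MixedHodgeStructure V'}
    (h₁ : ∀ a b, H₁.hodgeNumber a b ≠ 0 → (a = 1 ∧ b = 0) ∨ (a = 0 ∧ b = 1)) :
    finrank ℚ ((hom H₁ H₂).hodgeClasses 0) ≤
      H₁.hodgeNumber 1 0 * H₂.hodgeNumber 1 0 + H₁.hodgeNumber 0 1 * H₂.hodgeNumber 0 1 := by
  rw [← finsum_finsum_eq_of_weightOne (g := fun a b => H₂.hodgeNumber a b) h₁]
  exact finrank_hom_le_finsum_hodgeNumber H₁ H₂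

/-- **Weight one: `dim_ℚ End_MHS(H) ≤ 2 · h^{1,0}(H)²`** for `H` with Hodge types in `{(1,0), (0,1)}` (Hodge symmetry
`h^{0,1} = h^{1,0}`) — `= 2g²` for the `H¹` of a complex torus or abelian variety of dimension `g = h^{1,0}`, the
classical bound `[End_ℚ(A) : ℚ] ≤ 2g²` from `ρ_r ⊗ 1 ≃ ρ_a ⊕ \bar ρ_a`. [cite: LangeRodriguez2022, §2.1 eq. (2.6)]
[cite: CattaniElZeinGriffithsLe2014, §3.2.2.6 and §3.2.2.7] -/
theorem finrank_end_le_of_weightOne {H : MixedHodgeStructure V}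
    (h : ∀ a b, H.hodgeNumber a b ≠ 0 → (a = 1 ∧ b = 0) ∨ (a = 0 ∧ b = 1)) :
    finrank ℚ ((hom H H).hodgeClasses 0) ≤ 2 * H.hodgeNumber 1 0 ^ 2 := by
  refine (finrank_hom_le_of_weightOne (H₂ := H) h).trans_eq ?_
  rw [hodgeNumber_symm H 0 1]
  ring

/-- A pure MHS of weight `1` with `h^{a,1-a} = 0` for `a ∉ {0, 1}` has Hodge types in `{(1,0), (0,1)}` (the
hypothesis of the two previous statements). [cite: CattaniElZeinGriffithsLe2014, §3.2.2.6 and Def. 3.2.15] -/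
theorem IsPure.hodgeNumber_ne_zero_imp_of_weightOne {H : MixedHodgeStructure V} (hH : H.IsPure 1)
    (hlevel : ∀ a, a ≠ 0 → a ≠ 1 → H.hodgeNumber a (1 - a) = 0) (a b : ℤ) (hab : H.hodgeNumber a b ≠ 0) :
    (a = 1 ∧ b = 0) ∨ (a = 0 ∧ b = 1) := by
  have hsum : a + b = 1 := by
    by_contra hne
    exact hab (hodgeNumber_eq_zero_of_isPure hH hne)
  have hb : b = 1 - a := by omega
  subst hb
  by_cases ha0 : a = 0
  · exact Or.inr ⟨ha0, by omega⟩
  by_cases ha1 : a = 1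
  · exact Or.inl ⟨ha1, by omega⟩
  exact absurd (hlevel a ha0 ha1) hab

end MixedHodgeStructure

end Literature.AlgebraicGeometry.Motives
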